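import Summits.KontsevichZagierPeriods.KontsevichZagierPeriods.Theorems.RootDecompZetaThreeFrontierGZLadderRungThree
import Literature.NumberTheory.Transcendental.EllIterRepShuffle
import Summits.KontsevichZagierPeriods.KontsevichZagierPeriods.Theorems.RootDecompZetaThreeFrontierGZLadderLeTwo
import Summits.KontsevichZagierPeriods.KontsevichZagierPeriods.Theorems.RootDecompZetaThreeFrontierWordMatchPreludeP10
import Summits.KontsevichZagierPeriods.KontsevichZagierPeriods.Theorems.RootDecompZetaThreeFrontierWordEdge
import Summits.KontsevichZagierPeriods.KontsevichZagierPeriods.Theorems.RootDecompZetaThreeFrontierWordMovesPole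
import HarnessLib

/-! # `RootDecompZetaThreeFrontierRungFourPreludeP01` — part 1/14 of the mechanical ≤400-line split of `pre_src.lean` (sha256 ba362a5194d75c20…)
Source: decomp-kz lens-1 g12/g13 rung-4 prelude = Prelude_v3.lean @ba362a51 (Basis22_v1 sections RotFour/Shuffle/ProdFour/GenFb/WordMoves/RungFour/Basis22 + FacetGeneric_v2 §1–§23; critic CLEARED g6 row 330 / g6-20 l.1368); --supports stmt-KontsevichZagierPeriods-27141.
Split by census-1 g10 `gen/splitlean.py`: scopes re-opened with their `open`/`variable`/`set_option` context; mathematics and declaration order unchanged. -/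

/-! # PRELUDE (g13 merge, v2): Basis22_v1 (Rot4/Shuffle/Prod4/Gen22/WordMoves/Rung4_v3 §0–§5/Basis22) + FacetGeneric_v2 §1–§22 (dedup;
necessity kernels §6–§7 and the single-frame test §23 omitted — not needed by the certificate) -/

/-!
# `CellZeta 4` ⟸ the ℚ-linear certificate ALONE: all 22 basis moves of the k = 4 blueprint are proved (RUNG4 §19)

Self-contained merge (imports only LANDED tree modules) of the published node files
`Rot4_v1` (§A rotation/reflection moves) · `Shuffle_v1` (§B shuffle products) · `Prod4_v3` (§C the (2,2)/(1,3)/(3,1) product charts, `F_b`)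
· `Gen22_v1` §C–§D (§D generator 22) · `WordMoves_v1` §C (§E the 21 dihedral word images) · `Rung4_v3` (§F the typed rung, `CellZeta`,
`cellZeta_of_basis_words`) and the new §G:

* `Basis22.B22 : Fin 22 → (Fin 4 → ℝ) → ℝ` — the blueprint basis of the convergent logarithmic 4-forms on `Δ₄`
  (`exp/k4_certificate_data_rot4.json`: 7 + 7 + 7 dihedral images `(ρ^m δ^e)^* ω_w` of `w = 0001, 0011, 0101`, and `F_b`);
* `Basis22.basisMoves_B22 : ∀ i c, ∃ r, r.domain = Δ₄ ∧ EqOn r.integrand (c · B22 i) Δ₄ ∧ CongInto (words 4) (KZ.of r)` — PROVED;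
* `Basis22.cellZeta_four_of_certificate : (∀ s on Δ₄ with IsLogOn integrand, ∃ c : Fin 22 → ℚ, s.integrand = Σ cᵢ B22 i on Δ₄) → CellZeta 4`.

So the (C₄) instrument `CellZeta 4` is reduced to JOB C (pure ℚ-linear algebra + the residue necessity of `FacetGeneric_v2` §22–§23).
-/

set_option linter.dupNamespace false

noncomputable section

namespace Summit.KontsevichZagierPeriods.KontsevichZagierPeriods.Cruxes.GZNormalFormWThree.GZLadder.RotFour

open Set MeasureTheory MvPolynomial
open Literature.NumberTheory.Transcendental
open Literature.ModelTheory.ExponentialFields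

/-! ## 1  Membership in `Δ₄` -/

/-- Auxiliary step `mem_simplex_four_iff`: mem simplex four iff. [bookkeeping] -/
theorem mem_simplex_four_iff (t : Fin 4 → ℝ) :
    t ∈ KZ.openOrderedSimplex 4 ↔ 0 < t 3 ∧ t 3 < t 2 ∧ t 2 < t 1 ∧ t 1 < t 0 ∧ t 0 < 1 := by
  constructor
  · rintro ⟨h0, h1, ha⟩
    exact ⟨h0 3, ha (show (2 : Fin 4) < 3 by decide), ha (show (1 : Fin 4) < 2 by decide),
      ha (show (0 : Fin 4) < 1 by decide), h1 0⟩
  · rintro ⟨h3, h32, h21, h10, h0⟩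
    have hsa : StrictAnti t := by
      refine Fin.strictAnti_iff_succ_lt.mpr fun i => ?_
      fin_cases i
      · simpa using h10
      · simpa using h21
      · simpa using h32
    exact ⟨fun i => lt_of_lt_of_le h3 (hsa.antitone (Fin.le_last i)),
      fun i => lt_of_le_of_lt (hsa.antitone (Fin.le_iff_val_le_val.2 (Nat.zero_le _))) h0, hsa⟩

/-! ## 2  The parameter cell `P` -/

/-- `P = {(a,b,c,d) : 1 > a > b > c > 0, d > 0, a·b·d < 1}`. -/
def rtDom : Set (Fin 4 → ℝ) :=
  {p | p 1 < p 0 ∧ p 0 < 1 ∧ p 2 < p 1 ∧ 0 < p 2 ∧ 0 < p 3 ∧ p 0 * p 1 * p 3 < 1}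

/-- Auxiliary step `mem_rtDom_iff`: mem rt Dom iff. [bookkeeping] -/
theorem mem_rtDom_iff (p : Fin 4 → ℝ) :
    p ∈ rtDom ↔ p 1 < p 0 ∧ p 0 < 1 ∧ p 2 < p 1 ∧ 0 < p 2 ∧ 0 < p 3 ∧ p 0 * p 1 * p 3 < 1 := Iff.rfl

/-- Auxiliary step `isSemialgebraic_pos4`: is Semialgebraic pos4. [bookkeeping] -/
theorem isSemialgebraic_pos4 (q : MvPolynomial (Fin 4) ℚ) :
    IsSemialgebraic ℚ {p : Fin 4 → ℝ | 0 < MvPolynomial.aeval p q} :=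
  Literature.ModelTheory.ExponentialFields.isSemialgebraic_setOf_eval_pos (k := ℚ) q

/-- Auxiliary step `isSemialgebraic_rtDom`: is Semialgebraic rt Dom. [bookkeeping] -/
theorem isSemialgebraic_rtDom : IsSemialgebraic ℚ rtDom := by
  have e : rtDom =
      ((((({p : Fin 4 → ℝ | 0 < MvPolynomial.aeval p (X 0 - X 1 : MvPolynomial (Fin 4) ℚ)} ∩
        {p | 0 < MvPolynomial.aeval p (C 1 - X 0 : MvPolynomial (Fin 4) ℚ)}) ∩
        {p | 0 < MvPolynomial.aeval p (X 1 - X 2 : MvPolynomial (Fin 4) ℚ)}) ∩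
        {p | 0 < MvPolynomial.aeval p (X 2 : MvPolynomial (Fin 4) ℚ)}) ∩
        {p | 0 < MvPolynomial.aeval p (X 3 : MvPolynomial (Fin 4) ℚ)}) ∩
        {p | 0 < MvPolynomial.aeval p (C 1 - X 0 * X 1 * X 3 : MvPolynomial (Fin 4) ℚ)}) := by
    ext p
    simp only [mem_rtDom_iff, Set.mem_inter_iff, Set.mem_setOf_eq, map_sub, map_mul,
      MvPolynomial.aeval_X, map_one, sub_pos]
    tauto
  rw [e]
  exact (((((isSemialgebraic_pos4 _).inter (isSemialgebraic_pos4 _)).inter (isSemialgebraic_pos4 _)).inter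
    (isSemialgebraic_pos4 _)).inter (isSemialgebraic_pos4 _)).inter (isSemialgebraic_pos4 _)

/-- Auxiliary step `measurableSet_rtDom`: measurable Set rt Dom. [bookkeeping] -/
theorem measurableSet_rtDom : MeasurableSet rtDom :=
  IsSemialgebraic.measurableSet_holds isSemialgebraic_rtDom

/-- Auxiliary step `rtDom_facts`: rt Dom facts. [bookkeeping] -/
theorem rtDom_facts {p : Fin 4 → ℝ} (hp : p ∈ rtDom) :
    0 < p 0 ∧ 0 < p 1 ∧ 0 < p 2 ∧ 0 < p 3 ∧ p 0 ≠ 0 ∧ p 1 ≠ 0 ∧ p 2 ≠ 0 ∧ p 3 ≠ 0 := by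
  obtain ⟨h10, h0, h21, h2, h3, hlt⟩ := hp
  refine ⟨by linarith, by linarith, h2, h3, by linarith, by linarith, h2.ne', h3.ne'⟩

/-! ## 3  The rotation `ρ` and the two polynomial charts -/

/-- the rotation `ρ(t) = (1 - t₃, 1 - t₃/t₀, 1 - t₃/t₁, 1 - t₃/t₂)` (one step of `D₇` on `M_{0,7}`). -/
def rot4 (t : Fin 4 → ℝ) : Fin 4 → ℝ := ![1 - t 3, 1 - t 3 / t 0, 1 - t 3 / t 1, 1 - t 3 / t 2]

/-- chart A: `Ψ_A(a,b,c,d) = (a, b, c, abcd)`. -/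
def rtA (p : Fin 4 → ℝ) : Fin 4 → ℝ := ![p 0, p 1, p 2, p 0 * p 1 * p 2 * p 3]

/-- chart B: `Ψ_B(a,b,c,d) = (1 - abcd, 1 - bcd, 1 - acd, 1 - abd) = ρ (Ψ_A (a,b,c,d))`. -/
def rtB (p : Fin 4 → ℝ) : Fin 4 → ℝ :=
  ![1 - p 0 * p 1 * p 2 * p 3, 1 - p 1 * p 2 * p 3, 1 - p 0 * p 2 * p 3, 1 - p 0 * p 1 * p 3]

/-- Auxiliary step `rot4_zero`: rot4 zero. [bookkeeping] -/
theorem rot4_zero (t : Fin 4 → ℝ) : rot4 t 0 = 1 - t 3 := rfl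
/-- Auxiliary step `rot4_one`: rot4 one. [bookkeeping] -/
theorem rot4_one (t : Fin 4 → ℝ) : rot4 t 1 = 1 - t 3 / t 0 := rfl
/-- Auxiliary step `rot4_two`: rot4 two. [bookkeeping] -/
theorem rot4_two (t : Fin 4 → ℝ) : rot4 t 2 = 1 - t 3 / t 1 := rfl
/-- Auxiliary step `rot4_three`: rot4 three. [bookkeeping] -/
theorem rot4_three (t : Fin 4 → ℝ) : rot4 t 3 = 1 - t 3 / t 2 := rfl
/-- Auxiliary step `rtA_zero`: rt A zero. [bookkeeping] -/
theorem rtA_zero (p : Fin 4 → ℝ) : rtA p 0 = p 0 := rfl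
/-- Auxiliary step `rtA_one`: rt A one. [bookkeeping] -/
theorem rtA_one (p : Fin 4 → ℝ) : rtA p 1 = p 1 := rfl
/-- Auxiliary step `rtA_two`: rt A two. [bookkeeping] -/
theorem rtA_two (p : Fin 4 → ℝ) : rtA p 2 = p 2 := rfl
/-- Auxiliary step `rtA_three`: rt A three. [bookkeeping] -/
theorem rtA_three (p : Fin 4 → ℝ) : rtA p 3 = p 0 * p 1 * p 2 * p 3 := rfl
/-- Auxiliary step `rtB_zero`: rt B zero. [bookkeeping] -/
theorem rtB_zero (p : Fin 4 → ℝ) : rtB p 0 = 1 - p 0 * p 1 * p 2 * p 3 := rfl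
/-- Auxiliary step `rtB_one`: rt B one. [bookkeeping] -/
theorem rtB_one (p : Fin 4 → ℝ) : rtB p 1 = 1 - p 1 * p 2 * p 3 := rfl
/-- Auxiliary step `rtB_two`: rt B two. [bookkeeping] -/
theorem rtB_two (p : Fin 4 → ℝ) : rtB p 2 = 1 - p 0 * p 2 * p 3 := rfl
/-- Auxiliary step `rtB_three`: rt B three. [bookkeeping] -/
theorem rtB_three (p : Fin 4 → ℝ) : rtB p 3 = 1 - p 0 * p 1 * p 3 := rfl

/-- `Ψ_B = ρ ∘ Ψ_A` on `P`. -/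
theorem rot4_rtA {p : Fin 4 → ℝ} (hp : p ∈ rtDom) : rot4 (rtA p) = rtB p := by
  obtain ⟨-, -, -, -, ha, hb, hc, -⟩ := rtDom_facts hp
  funext i
  fin_cases i
  · simp [rot4_zero, rtA_three, rtB_zero]
  · simp [rot4_one, rtA_three, rtA_zero, rtB_one]; field_simp
  · simp [rot4_two, rtA_three, rtA_one, rtB_two]; field_simp
  · simp [rot4_three, rtA_three, rtA_two, rtB_three]; field_simp

/-! ## 4  Derivatives and Jacobian determinants of the charts -/

/-- coordinate projections -/
abbrev Pj (i : Fin 4) : (Fin 4 → ℝ) →L[ℝ] ℝ :=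
  ContinuousLinearMap.proj (R := ℝ) (φ := fun _ : Fin 4 => ℝ) i

/-- `D(q ↦ q i * q j * q k)` at `p`, in the shape produced by `HasFDerivAt.mul`. -/
def d3 (p : Fin 4 → ℝ) (i j k : Fin 4) : (Fin 4 → ℝ) →L[ℝ] ℝ :=
  (p i * p j) • Pj k + p k • (p i • Pj j + p j • Pj i)

/-- `D(q ↦ q 0 * q 1 * q 2 * q 3)` at `p`. -/
def d4 (p : Fin 4 → ℝ) : (Fin 4 → ℝ) →L[ℝ] ℝ :=
  (p 0 * p 1 * p 2) • Pj 3 + p 3 • d3 p 0 1 2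

/-- Auxiliary step `hasFDerivAt_coord`: has FDeriv At coord. [bookkeeping] -/
theorem hasFDerivAt_coord (i : Fin 4) (p : Fin 4 → ℝ) :
    HasFDerivAt (fun q : Fin 4 → ℝ => q i) (Pj i) p := hasFDerivAt_apply (𝕜 := ℝ) i p

/-- Auxiliary step `hasFDerivAt_d3`: has FDeriv At d3. [bookkeeping] -/
theorem hasFDerivAt_d3 (p : Fin 4 → ℝ) (i j k : Fin 4) :
    HasFDerivAt (fun q : Fin 4 → ℝ => q i * q j * q k) (d3 p i j k) p :=
  ((hasFDerivAt_coord i p).mul (hasFDerivAt_coord j p)).mul (hasFDerivAt_coord k p)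

/-- Auxiliary step `hasFDerivAt_d4`: has FDeriv At d4. [bookkeeping] -/
theorem hasFDerivAt_d4 (p : Fin 4 → ℝ) :
    HasFDerivAt (fun q : Fin 4 → ℝ => q 0 * q 1 * q 2 * q 3) (d4 p) p :=
  (hasFDerivAt_d3 p 0 1 2).mul (hasFDerivAt_coord 3 p)

/-- Auxiliary step `d3_apply`: d3 apply. [bookkeeping] -/
theorem d3_apply (p h : Fin 4 → ℝ) (i j k : Fin 4) :
    d3 p i j k h = p i * p j * h k + p k * (p i * h j + p j * h i) := by
  simp [d3]
  ring

/-- Auxiliary step `d4_apply`: d4 apply. [bookkeeping] -/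
theorem d4_apply (p h : Fin 4 → ℝ) :
    d4 p h = p 0 * p 1 * p 2 * h 3 + p 3 * (p 0 * p 1 * h 2 + p 2 * (p 0 * h 1 + p 1 * h 0)) := by
  simp [d4, d3_apply]

/-- rows of `DΨ_A`. -/
def rtARow (p : Fin 4 → ℝ) : Fin 4 → ((Fin 4 → ℝ) →L[ℝ] ℝ) := ![Pj 0, Pj 1, Pj 2, d4 p]

/-- `DΨ_A (p)`. -/
def rtAL (p : Fin 4 → ℝ) : (Fin 4 → ℝ) →L[ℝ] (Fin 4 → ℝ) := ContinuousLinearMap.pi (rtARow p)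

/-- rows of `DΨ_B`. -/
def rtBRow (p : Fin 4 → ℝ) : Fin 4 → ((Fin 4 → ℝ) →L[ℝ] ℝ) :=
  ![-d4 p, -d3 p 1 2 3, -d3 p 0 2 3, -d3 p 0 1 3]

/-- `DΨ_B (p)`. -/
def rtBL (p : Fin 4 → ℝ) : (Fin 4 → ℝ) →L[ℝ] (Fin 4 → ℝ) := ContinuousLinearMap.pi (rtBRow p)

/-- Auxiliary step `rtAL_apply`: rt AL apply. [bookkeeping] -/
theorem rtAL_apply (p h : Fin 4 → ℝ) (i : Fin 4) : rtAL p h i = rtARow p i h := rfl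
/-- Auxiliary step `rtBL_apply`: rt BL apply. [bookkeeping] -/
theorem rtBL_apply (p h : Fin 4 → ℝ) (i : Fin 4) : rtBL p h i = rtBRow p i h := rfl

/-- Auxiliary step `hasFDerivAt_rtA`: has FDeriv At rt A. [bookkeeping] -/
theorem hasFDerivAt_rtA (p : Fin 4 → ℝ) : HasFDerivAt rtA (rtAL p) p := by
  have key : HasFDerivAt (fun q : Fin 4 → ℝ => fun i => (![q 0, q 1, q 2, q 0 * q 1 * q 2 * q 3] :
      Fin 4 → ℝ) i) (ContinuousLinearMap.pi (rtARow p)) p := by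
    refine hasFDerivAt_pi.2 fun i => ?_
    fin_cases i
    · simpa [rtARow] using hasFDerivAt_coord 0 p
    · simpa [rtARow] using hasFDerivAt_coord 1 p
    · simpa [rtARow] using hasFDerivAt_coord 2 p
    · simpa [rtARow] using hasFDerivAt_d4 p
  exact key

/-- Auxiliary step `hasFDerivAt_rtB`: has FDeriv At rt B. [bookkeeping] -/
theorem hasFDerivAt_rtB (p : Fin 4 → ℝ) : HasFDerivAt rtB (rtBL p) p := by
  have key : HasFDerivAt (fun q : Fin 4 → ℝ => fun i =>
      (![1 - q 0 * q 1 * q 2 * q 3, 1 - q 1 * q 2 * q 3, 1 - q 0 * q 2 * q 3, 1 - q 0 * q 1 * q 3] :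
      Fin 4 → ℝ) i) (ContinuousLinearMap.pi (rtBRow p)) p := by
    refine hasFDerivAt_pi.2 fun i => ?_
    fin_cases i
    · simpa [rtBRow] using (hasFDerivAt_d4 p).const_sub 1
    · simpa [rtBRow] using (hasFDerivAt_d3 p 1 2 3).const_sub 1
    · simpa [rtBRow] using (hasFDerivAt_d3 p 0 2 3).const_sub 1
    · simpa [rtBRow] using (hasFDerivAt_d3 p 0 1 3).const_sub 1
  exact key

/-- Jacobian matrix of `Ψ_A`. -/
def rtAM (p : Fin 4 → ℝ) : Matrix (Fin 4) (Fin 4) ℝ :=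
  !![1, 0, 0, 0; 0, 1, 0, 0; 0, 0, 1, 0;
     p 1 * p 2 * p 3, p 0 * p 2 * p 3, p 0 * p 1 * p 3, p 0 * p 1 * p 2]

/-- Jacobian matrix of `Ψ_B`. -/
def rtBM (p : Fin 4 → ℝ) : Matrix (Fin 4) (Fin 4) ℝ :=
  !![-(p 1 * p 2 * p 3), -(p 0 * p 2 * p 3), -(p 0 * p 1 * p 3), -(p 0 * p 1 * p 2);
     0, -(p 2 * p 3), -(p 1 * p 3), -(p 1 * p 2);
     -(p 2 * p 3), 0, -(p 0 * p 3), -(p 0 * p 2);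
     -(p 1 * p 3), -(p 0 * p 3), 0, -(p 0 * p 1)]

/-- Auxiliary step `rtAL_eq_toLin'`: rt AL eq to Lin'. [bookkeeping] -/
theorem rtAL_eq_toLin' (p : Fin 4 → ℝ) :
    (rtAL p : (Fin 4 → ℝ) →ₗ[ℝ] (Fin 4 → ℝ)) = Matrix.toLin' (rtAM p) := by
  apply LinearMap.ext
  intro h
  rw [Matrix.toLin'_apply, ContinuousLinearMap.coe_coe]
  funext i
  rw [rtAL_apply]
  fin_cases i
  · simp [rtARow, rtAM, Matrix.mulVec, dotProduct, Fin.sum_univ_four]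
  · simp [rtARow, rtAM, Matrix.mulVec, dotProduct, Fin.sum_univ_four]
  · simp [rtARow, rtAM, Matrix.mulVec, dotProduct, Fin.sum_univ_four]
  · simp [rtARow, rtAM, Matrix.mulVec, dotProduct, Fin.sum_univ_four, d4_apply]; ring

/-- Auxiliary step `rtBL_eq_toLin'`: rt BL eq to Lin'. [bookkeeping] -/
theorem rtBL_eq_toLin' (p : Fin 4 → ℝ) :
    (rtBL p : (Fin 4 → ℝ) →ₗ[ℝ] (Fin 4 → ℝ)) = Matrix.toLin' (rtBM p) := by
  apply LinearMap.ext
  intro h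
  rw [Matrix.toLin'_apply, ContinuousLinearMap.coe_coe]
  funext i
  rw [rtBL_apply]
  fin_cases i
  · simp [rtBRow, rtBM, Matrix.mulVec, dotProduct, Fin.sum_univ_four, d4_apply]; ring
  · simp [rtBRow, rtBM, Matrix.mulVec, dotProduct, Fin.sum_univ_four, d3_apply]; ring
  · simp [rtBRow, rtBM, Matrix.mulVec, dotProduct, Fin.sum_univ_four, d3_apply]; ring
  · simp [rtBRow, rtBM, Matrix.mulVec, dotProduct, Fin.sum_univ_four, d3_apply]; ring

/-- Auxiliary step `det_rtAM`: det rt AM. [bookkeeping] -/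
theorem det_rtAM (p : Fin 4 → ℝ) : (rtAM p).det = p 0 * p 1 * p 2 := by
  rw [Matrix.det_succ_row_zero]
  simp [rtAM, Fin.sum_univ_succ, Matrix.det_fin_three, Fin.succAbove]
  
/-- Auxiliary step `det_rtBM`: det rt BM. [bookkeeping] -/
theorem det_rtBM (p : Fin 4 → ℝ) : (rtBM p).det = p 0 ^ 2 * p 1 ^ 2 * p 2 ^ 2 * p 3 ^ 3 := by
  rw [Matrix.det_succ_row_zero]
  simp [rtBM, Fin.sum_univ_succ, Matrix.det_fin_three, Fin.succAbove]
  ring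

/-- Auxiliary step `det_rtAL`: det rt AL. [bookkeeping] -/
theorem det_rtAL (p : Fin 4 → ℝ) : (rtAL p).det = p 0 * p 1 * p 2 := by
  show LinearMap.det (rtAL p : (Fin 4 → ℝ) →ₗ[ℝ] (Fin 4 → ℝ)) = _
  rw [rtAL_eq_toLin', LinearMap.det_toLin', det_rtAM]

/-- Auxiliary step `det_rtBL`: det rt BL. [bookkeeping] -/
theorem det_rtBL (p : Fin 4 → ℝ) : (rtBL p).det = p 0 ^ 2 * p 1 ^ 2 * p 2 ^ 2 * p 3 ^ 3 := by
  show LinearMap.det (rtBL p : (Fin 4 → ℝ) →ₗ[ℝ] (Fin 4 → ℝ)) = _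
  rw [rtBL_eq_toLin', LinearMap.det_toLin', det_rtBM]

/-- Auxiliary step `abs_det_rtAL`: abs det rt AL. [bookkeeping] -/
theorem abs_det_rtAL {p : Fin 4 → ℝ} (hp : p ∈ rtDom) : |(rtAL p).det| = p 0 * p 1 * p 2 := by
  obtain ⟨ha, hb, hc, -, -⟩ := rtDom_facts hp
  rw [det_rtAL, abs_of_pos (mul_pos (mul_pos ha hb) hc)]

/-- Auxiliary step `abs_det_rtBL`: abs det rt BL. [bookkeeping] -/
theorem abs_det_rtBL {p : Fin 4 → ℝ} (hp : p ∈ rtDom) :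
    |(rtBL p).det| = p 0 ^ 2 * p 1 ^ 2 * p 2 ^ 2 * p 3 ^ 3 := by
  obtain ⟨ha, hb, hc, hd, -⟩ := rtDom_facts hp
  rw [det_rtBL, abs_of_pos (by positivity)]

/-! ## 5  Both charts are bijections `P → Δ₄` -/

/-- Auxiliary step `rtA_mem`: rt A mem. [bookkeeping] -/
theorem rtA_mem {p : Fin 4 → ℝ} (hp : p ∈ rtDom) : rtA p ∈ KZ.openOrderedSimplex 4 := by
  obtain ⟨h10, h0, h21, h2, h3, hlt⟩ := hp
  rw [mem_simplex_four_iff, rtA_zero, rtA_one, rtA_two, rtA_three]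
  have ha : 0 < p 0 := by linarith
  have hb : 0 < p 1 := by linarith
  refine ⟨by positivity, ?_, h21, h10, h0⟩
  have : p 0 * p 1 * p 2 * p 3 = (p 0 * p 1 * p 3) * p 2 := by ring
  rw [this]
  exact mul_lt_of_lt_one_left h2 hlt

/-- `Ψ_A⁻¹(t) = (t₀, t₁, t₂, t₃/(t₀t₁t₂))`. -/
def rtAinv (t : Fin 4 → ℝ) : Fin 4 → ℝ := ![t 0, t 1, t 2, t 3 / (t 0 * t 1 * t 2)]

/-- Auxiliary step `rtAinv_mem`: rt Ainv mem. [bookkeeping] -/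
theorem rtAinv_mem {t : Fin 4 → ℝ} (ht : t ∈ KZ.openOrderedSimplex 4) : rtAinv t ∈ rtDom := by
  obtain ⟨h3, h32, h21, h10, h0⟩ := (mem_simplex_four_iff t).1 ht
  have h2 : 0 < t 2 := by linarith
  have h1 : 0 < t 1 := by linarith
  have h0' : 0 < t 0 := by linarith
  simp only [mem_rtDom_iff, rtAinv, Matrix.cons_val_zero, Matrix.cons_val_one, Matrix.head_cons,
    Matrix.cons_val_two, Matrix.tail_cons, Matrix.cons_val_three]
  refine ⟨h10, h0, h21, h2, by positivity, ?_⟩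
  have : t 0 * t 1 * (t 3 / (t 0 * t 1 * t 2)) = t 3 / t 2 := by field_simp
  rw [this, div_lt_one h2]
  exact h32

/-- Auxiliary step `rtA_rtAinv`: rt A rt Ainv. [bookkeeping] -/
theorem rtA_rtAinv {t : Fin 4 → ℝ} (ht : t ∈ KZ.openOrderedSimplex 4) : rtA (rtAinv t) = t := by
  obtain ⟨h3, h32, h21, h10, h0⟩ := (mem_simplex_four_iff t).1 ht
  have h2 : t 2 ≠ 0 := by linarith
  have h1 : t 1 ≠ 0 := by linarith
  have h0' : t 0 ≠ 0 := by linarith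
  funext i
  fin_cases i
  · simp [rtA, rtAinv]
  · simp [rtA, rtAinv]
  · simp [rtA, rtAinv]
  · simp [rtA, rtAinv]; field_simp

/-- Auxiliary step `rtAinv_rtA`: rt Ainv rt A. [bookkeeping] -/
theorem rtAinv_rtA {p : Fin 4 → ℝ} (hp : p ∈ rtDom) : rtAinv (rtA p) = p := by
  obtain ⟨-, -, -, -, ha, hb, hc, -⟩ := rtDom_facts hp
  funext i
  fin_cases i
  · simp [rtA, rtAinv]
  · simp [rtA, rtAinv]
  · simp [rtA, rtAinv]
  · simp [rtA, rtAinv]; field_simp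

/-- Auxiliary step `image_rtA`: image rt A. [bookkeeping] -/
theorem image_rtA : rtA '' rtDom = KZ.openOrderedSimplex 4 := by
  ext t
  constructor
  · rintro ⟨p, hp, rfl⟩
    exact rtA_mem hp
  · intro ht
    exact ⟨rtAinv t, rtAinv_mem ht, rtA_rtAinv ht⟩

/-- Auxiliary step `injOn_rtA`: inj On rt A. [bookkeeping] -/
theorem injOn_rtA : InjOn rtA rtDom :=
  fun p hp q hq h => by rw [← rtAinv_rtA hp, ← rtAinv_rtA hq, h]

/-- Auxiliary step `rtB_mem`: rt B mem. [bookkeeping] -/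
theorem rtB_mem {p : Fin 4 → ℝ} (hp : p ∈ rtDom) : rtB p ∈ KZ.openOrderedSimplex 4 := by
  obtain ⟨h10, h0, h21, h2, h3, hlt⟩ := hp
  have ha : 0 < p 0 := by linarith
  have hb : 0 < p 1 := by linarith
  rw [mem_simplex_four_iff, rtB_zero, rtB_one, rtB_two, rtB_three]
  refine ⟨by linarith, ?_, ?_, ?_, ?_⟩
  · nlinarith [mul_pos ha h3, mul_pos (mul_pos ha h3) (sub_pos.2 h21)]
  · nlinarith [mul_pos h2 h3, mul_pos (mul_pos h2 h3) (sub_pos.2 h10)]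
  · nlinarith [mul_pos (mul_pos hb h2) h3, mul_pos (mul_pos (mul_pos hb h2) h3) (sub_pos.2 h0)]
  · have : 0 < p 0 * p 1 * p 2 * p 3 := by positivity
    linarith

/-- `Ψ_B⁻¹(u) = ((1-u₀)/(1-u₁), (1-u₀)/(1-u₂), (1-u₀)/(1-u₃), (1-u₁)(1-u₂)(1-u₃)/(1-u₀)²)`. -/
def rtBinv (u : Fin 4 → ℝ) : Fin 4 → ℝ :=
  ![(1 - u 0) / (1 - u 1), (1 - u 0) / (1 - u 2), (1 - u 0) / (1 - u 3),
    (1 - u 1) * (1 - u 2) * (1 - u 3) / (1 - u 0) ^ 2]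

/-- Auxiliary step `rtBinv_zero`: rt Binv zero. [bookkeeping] -/
theorem rtBinv_zero (u : Fin 4 → ℝ) : rtBinv u 0 = (1 - u 0) / (1 - u 1) := rfl
/-- Auxiliary step `rtBinv_one`: rt Binv one. [bookkeeping] -/
theorem rtBinv_one (u : Fin 4 → ℝ) : rtBinv u 1 = (1 - u 0) / (1 - u 2) := rfl
/-- Auxiliary step `rtBinv_two`: rt Binv two. [bookkeeping] -/
theorem rtBinv_two (u : Fin 4 → ℝ) : rtBinv u 2 = (1 - u 0) / (1 - u 3) := rfl
/-- Auxiliary step `rtBinv_three`: rt Binv three. [bookkeeping] -/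
theorem rtBinv_three (u : Fin 4 → ℝ) :
    rtBinv u 3 = (1 - u 1) * (1 - u 2) * (1 - u 3) / (1 - u 0) ^ 2 := rfl

end Summit.KontsevichZagierPeriods.KontsevichZagierPeriods.Cruxes.GZNormalFormWThree.GZLadder.RotFour
end
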